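import Literature.AlgebraicGeometry.HodgeTheory.WeilClassesCMReductionProductForm
import Literature.AlgebraicGeometry.HodgeTheory.WeilClassesIsogenyDescent
import Literature.AlgebraicGeometry.HodgeTheory.AbelianVarietyPullbackAlgebraicClasses
import Literature.AlgebraicGeometry.ComplexMultiplication.ShimuraIsogenyHolds
import Literature.NumberTheory.DiophantineGeometry.AVKernelHopf
import HarnessLib

/-!
# Algebraicity of `K`-Weil-line classes is invariant under equivariant isogenies of CM families

For a finite family `A : J → AbelianVariety ℂ` with `𝓞_K`-actions `act_j` the tree has the complex
`K`-Weil-line classes `weilLineClasses A act k ⊂ Hᵏ((⨁_j A_j)(ℂ); ℂ)` (`WeilClassesCMReductionProductForm`: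
the sum over `s : K → ℂ` of the simultaneous `s(a)ᵏ`-eigenspaces of the diagonal action; Milne 2020 §2,
Deligne 1982 §4–5) and, for ONE endomorphism, the transport of algebraicity of the Weil PLANE along a
`K`-equivariant isogeny (`WeilClassesIsogenyDescent.mem_algebraicClasses_of_isogeny_of_mem_weilClassesOf`,
van Geemen 1994 3.6–3.7; Markman 2025 §11.5 Step 1).  This file is the same transport for the LINE of a family:

* `biproductMap_comp_diagonalAction` — slotwise equivariant `g_j : B_j → A_j` make `⊕ g_j` equivariant for the
  diagonal actions; `map_biproductMap_mem_iInf_eigenspace`, `map_weilLineClasses_le_weilLineClasses` — hence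
  `(⊕ g_j)^*` maps `K`-Weil-line classes of `A` to `K`-Weil-line classes of `B` (van Geemen 3.6: pull-backs commute
  with the action of `End_ℚ`);
* `diagonalAction_natCast`, `map_nsmul_id_eq_of_mem_weilLineClasses` — `[N]^* = Nᵏ` on the `K`-Weil-line classes
  in degree `k` (Milne 1986 §8: multiplication by `N` on `Hᵏ = ⋀ᵏ H¹`);
* **`weilLineClasses_le_algebraicClasses_of_equivariant_isogeny`** — if the `g_j` are ISOGENIES and every
  `K`-Weil-line class of `B` in degree `2p` is algebraic, so is every `K`-Weil-line class of `A` in degree `2p`: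
  pull back along `⊕ g_j`, return along `⊕ (N/n_j)·f_j` for quasi-inverses `f_j` (`g_j ∘ f_j = [n_j]`,
  `IsIsogeny.exists_nsmul_inverse_holds`; Mumford §19 Remark p. 169), whose composite with `⊕ g_j` is `[N]`;
  pull-backs of algebraic classes along homomorphisms of abelian varieties are algebraic
  (`map_mem_algebraicClasses_of_abelianVariety`);
* **`weilLineClasses_le_algebraicClasses_of_isCMTypeRealisation`** / `…_iff_…` — consequently the algebraicity of
  the `K`-Weil-line classes of a family of CM TYPE REALISATIONS `(A_j, act_j, θ_j) ⊨ (K; Ψ_j)` depends only on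
  the types `Ψ_j`: any two realisation families are slotwise equivariantly isogenous (Shimura 1998 §6.1,
  Corollary of Theorem 2 with the Remark; tree theorem `Shimura1998_Thm2_Cor_holds`).

No definition, no named fact; every declaration is a theorem over the tree's carriers.

## References
* [vanGeemen1994HodgeAV] B. van Geemen, *An introduction to the Hodge conjecture for abelian varieties*, LNM 1594
  (1994), 3.6–3.7.
* [Milne2020HodgeClassesAV] J. S. Milne, *Hodge classes on abelian varieties* (2020), §2, Theorem 1.
* [Shimura1998] G. Shimura, *Abelian Varieties with Complex Multiplication and Modular Functions* (1998), §6.1.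
* [MumfordAV1970] D. Mumford, *Abelian Varieties* (1970), §19 Remark p. 169.
* [Deligne1982HodgeCycles] P. Deligne, *Hodge cycles on abelian varieties*, LNM 900 (1982), §4–5, endnote M.12.
-/

noncomputable section

open CategoryTheory CategoryTheory.Limits NumberField
open Literature.AlgebraicTopology.SingularHomology
open Literature.AlgebraicGeometry.Motives Literature.AlgebraicGeometry.ComplexMultiplication

namespace Literature.AlgebraicGeometry.HodgeTheory

universe u

variable {K : Type} [Field K]
variable {J : Type} [Fintype J]

/-! ### Equivariance of `⊕ g_j` for the diagonal actions -/

/-- Componentwise composition of maps of biproducts: `(⊕ p_j) ≫ (⊕ q_j) = ⊕ (p_j ≫ q_j)` (category plumbing,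
private). [folklore] -/
private theorem biproductMap_comp_biproductMap {A B C : J → AbelianVariety ℂ} (p : ∀ j, A j ⟶ B j)
    (q : ∀ j, B j ⟶ C j) :
    biproduct.map p ≫ biproduct.map q = biproduct.map fun j => p j ≫ q j := by
  ext j
  simp only [Category.assoc, biproduct.map_π, biproduct.map_π_assoc]

/-- **Slotwise `𝓞_K`-equivariant homomorphisms are equivariant for the diagonal actions**: if
`act^B_j(a) ∘ g_j = g_j ∘ act^A_j(a)` for all `j`, `a` (i.e. `g_j ≫ act^A_j a = act^B_j a ≫ g_j` read as
`act^B_j a ≫ g_j = g_j ≫ act^A_j a` in diagrammatic order), then `(⊕ g_j) ≫ a_A = a_B ≫ (⊕ g_j)` (van Geemen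
3.6: homomorphisms commute with the `End_ℚ`-actions they intertwine). [cite: vanGeemen1994HodgeAV, 3.6] -/
theorem biproductMap_comp_diagonalAction {A B : J → AbelianVariety ℂ} (actA : ∀ j, 𝓞 K →+* End (A j))
    (actB : ∀ j, 𝓞 K →+* End (B j)) (g : ∀ j, B j ⟶ A j)
    (hg : ∀ (j) (a : 𝓞 K), (actB j a : B j ⟶ B j) ≫ g j = g j ≫ (actA j a : A j ⟶ A j)) (a : 𝓞 K) :
    biproduct.map g ≫ diagonalAction A actA a = diagonalAction B actB a ≫ biproduct.map g := by
  rw [diagonalAction_def, diagonalAction_def, biproductMap_comp_biproductMap, biproductMap_comp_biproductMap]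
  congr 1
  funext j
  exact (hg j a).symm

/-- **`(⊕ g_j)^*` maps simultaneous `s`-eigenclasses of `A` to simultaneous `s`-eigenclasses of `B`**
(`a_B^* (⊕g)^* c = ((a_B ≫ ⊕g))^* c = ((⊕g) ≫ a_A)^* c = (⊕g)^* a_A^* c = s(a)ᵏ (⊕g)^* c`).
[cite: vanGeemen1994HodgeAV, 3.6 and proof of Lemma 5.2] -/
theorem map_biproductMap_mem_iInf_eigenspace {A B : J → AbelianVariety ℂ} (actA : ∀ j, 𝓞 K →+* End (A j))
    (actB : ∀ j, 𝓞 K →+* End (B j)) (g : ∀ j, B j ⟶ A j)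
    (hg : ∀ (j) (a : 𝓞 K), (actB j a : B j ⟶ B j) ≫ g j = g j ≫ (actA j a : A j ⟶ A j))
    (k : ℕ) (s : K →+* ℂ) {c : complexBetti (⨁ A).X k}
    (hc : c ∈ ⨅ a : 𝓞 K, Module.End.eigenspace
      (complexBetti.map (diagonalAction A actA a).hom.hom.hom k).hom ((s a) ^ k)) :
    complexBetti.map (biproduct.map g).hom.hom.hom k c ∈ ⨅ a : 𝓞 K, Module.End.eigenspace
      (complexBetti.map (diagonalAction B actB a).hom.hom.hom k).hom ((s a) ^ k) := by
  rw [Submodule.mem_iInf] at hc ⊢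
  intro a
  have h := Module.End.mem_eigenspace_iff.1 (hc a)
  rw [Module.End.mem_eigenspace_iff]
  change complexBetti.map (diagonalAction B actB a).hom.hom.hom k
      (complexBetti.map (biproduct.map g).hom.hom.hom k c) = _
  rw [abelianVarietyHom_map_map_apply, ← biproductMap_comp_diagonalAction actA actB g hg a,
    ← abelianVarietyHom_map_map_apply]
  change complexBetti.map (biproduct.map g).hom.hom.hom k
      ((complexBetti.map (diagonalAction A actA a).hom.hom.hom k).hom c) = _
  rw [h, map_smul]

/-- **`(⊕ g_j)^*` maps the `K`-Weil-line classes of `A` into those of `B`** (for slotwise equivariant `g_j`).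
[cite: vanGeemen1994HodgeAV, 3.6 and proof of Lemma 5.2] [cite: Milne2020HodgeClassesAV, §2.1–2.2] -/
theorem map_weilLineClasses_le_weilLineClasses {A B : J → AbelianVariety ℂ} (actA : ∀ j, 𝓞 K →+* End (A j))
    (actB : ∀ j, 𝓞 K →+* End (B j)) (g : ∀ j, B j ⟶ A j)
    (hg : ∀ (j) (a : 𝓞 K), (actB j a : B j ⟶ B j) ≫ g j = g j ≫ (actA j a : A j ⟶ A j)) (k : ℕ) :
    (weilLineClasses A actA k).map (complexBetti.map (biproduct.map g).hom.hom.hom k).hom ≤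
      weilLineClasses B actB k := by
  unfold weilLineClasses
  rw [Submodule.map_iSup]
  exact iSup_mono fun s => Submodule.map_le_iff_le_comap.2 fun c hc =>
    map_biproductMap_mem_iInf_eigenspace actA actB g hg k s hc

/-- Pointwise form: `(⊕ g_j)^* c` is a `K`-Weil-line class of `B` for every `K`-Weil-line class `c` of `A`.
[cite: vanGeemen1994HodgeAV, 3.6 and proof of Lemma 5.2] -/
theorem map_biproductMap_mem_weilLineClasses {A B : J → AbelianVariety ℂ} (actA : ∀ j, 𝓞 K →+* End (A j))
    (actB : ∀ j, 𝓞 K →+* End (B j)) (g : ∀ j, B j ⟶ A j)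
    (hg : ∀ (j) (a : 𝓞 K), (actB j a : B j ⟶ B j) ≫ g j = g j ≫ (actA j a : A j ⟶ A j)) (k : ℕ)
    {c : complexBetti (⨁ A).X k} (hc : c ∈ weilLineClasses A actA k) :
    complexBetti.map (biproduct.map g).hom.hom.hom k c ∈ weilLineClasses B actB k :=
  map_weilLineClasses_le_weilLineClasses actA actB g hg k (Submodule.mem_map_of_mem hc)

/-! ### Multiplication by `N` on the `K`-Weil-line classes -/

/-- The diagonal action of the integer `N ∈ 𝓞_K` is multiplication by `N` on `⨁_j A_j` (each `act_j` is a ring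
homomorphism, so `act_j(N) = [N]`). [cite: Deligne1982HodgeCycles, endnote M.12 (p. 64)] -/
theorem diagonalAction_natCast {A : J → AbelianVariety ℂ} (act : ∀ j, 𝓞 K →+* End (A j)) (N : ℕ) :
    diagonalAction A act (N : 𝓞 K) = N • 𝟙 (⨁ A) := by
  have h1 : ∀ j, (act j (N : 𝓞 K) : A j ⟶ A j) = N • 𝟙 (A j) := fun j => by
    rw [map_natCast, ← Nat.smul_one_eq_cast]
    rfl
  rw [diagonalAction_def]
  ext j
  simp only [biproduct.map_π, h1, Preadditive.comp_nsmul, Preadditive.nsmul_comp, Category.comp_id,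
    Category.id_comp]

/-- **`[N]^* = Nᵏ` on the `K`-Weil-line classes in degree `k`**: for `c ∈ weilLineClasses A act k`,
`(N • 𝟙)^* c = Nᵏ · c` (on each simultaneous `s`-eigenspace `[N] = act(N)` acts by `s(N)ᵏ = Nᵏ`).
[cite: Milne2020HodgeClassesAV, §2.1–2.2] [cite: vanGeemen1994HodgeAV, 3.6] -/
theorem map_nsmul_id_eq_of_mem_weilLineClasses {A : J → AbelianVariety ℂ} (act : ∀ j, 𝓞 K →+* End (A j))
    (k N : ℕ) {c : complexBetti (⨁ A).X k} (hc : c ∈ weilLineClasses A act k) :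
    complexBetti.map (N • 𝟙 (⨁ A) : (⨁ A) ⟶ ⨁ A).hom.hom.hom k c = ((N : ℂ) ^ k) • c := by
  rw [← diagonalAction_natCast act N]
  unfold weilLineClasses at hc
  induction hc using Submodule.iSup_induction' with
  | mem s x hx =>
    rw [Submodule.mem_iInf] at hx
    have h := Module.End.mem_eigenspace_iff.1 (hx (N : 𝓞 K))
    rw [show ((N : 𝓞 K) : K) = (N : K) from rfl, map_natCast] at h
    exact h
  | zero => simp only [map_zero, smul_zero]
  | add x y _ _ hx hy => rw [map_add, hx, hy, smul_add]

/-! ### Transport of algebraicity -/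

/-- **Algebraicity of `K`-Weil-line classes is invariant under slotwise equivariant isogeny.**  Let
`g_j : B_j → A_j` be `𝓞_K`-equivariant ISOGENIES of the slots of two families with `𝓞_K`-actions.  If every
`K`-Weil-line class of `⨁_j B_j` in degree `2p` is algebraic, then every `K`-Weil-line class `c` of `⨁_j A_j` in
degree `2p` is algebraic: `(⊕g)^* c` is a `K`-Weil-line class of `B` (`map_biproductMap_mem_weilLineClasses`),
hence algebraic; with quasi-inverses `f_j`, `f_j ≫ g_j = [n_j]` (Mumford §19 Remark p. 169, tree theorem
`IsIsogeny.exists_nsmul_inverse_holds`) and `N = ∏ n_j`, the homomorphism `F = ⊕ (N/n_j)·f_j` satisfies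
`F ≫ ⊕g = [N]`, so `F^* (⊕g)^* c = [N]^* c = N^{2p} · c` is algebraic (`map_mem_algebraicClasses_of_abelianVariety`),
and `N^{2p} ≠ 0`. [cite: vanGeemen1994HodgeAV, 3.6–3.7 and proof of Lemma 5.2] [cite: MumfordAV1970, §19 Remark p. 169] -/
theorem weilLineClasses_le_algebraicClasses_of_equivariant_isogeny {A B : J → AbelianVariety ℂ}
    (actA : ∀ j, 𝓞 K →+* End (A j)) (actB : ∀ j, 𝓞 K →+* End (B j)) (g : ∀ j, B j ⟶ A j)
    (hg : ∀ (j) (a : 𝓞 K), (actB j a : B j ⟶ B j) ≫ g j = g j ≫ (actA j a : A j ⟶ A j))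
    (hiso : ∀ j, AbelianVariety.IsIsogeny (g j)) {p : ℕ}
    (hB : weilLineClasses B actB (2 * p) ≤ algebraicClasses (⨁ B).X p) :
    weilLineClasses A actA (2 * p) ≤ algebraicClasses (⨁ A).X p := by
  classical
  -- quasi-inverses `f_j` with `g_j ≫ f_j = [n_j]`, `f_j ≫ g_j = [n_j]`, and a common multiplier `N = ∏ n_j`
  choose f n hn hgf hfg using fun j => AbelianVariety.IsIsogeny.exists_nsmul_inverse_holds (hiso j)
  set N : ℕ := ∏ j, n j with hNdef
  have hN : 0 < N := Finset.prod_pos fun j _ => hn j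
  have hdvd : ∀ j, n j ∣ N := fun j => Finset.dvd_prod_of_mem n (Finset.mem_univ j)
  set F : (⨁ A) ⟶ ⨁ B := biproduct.map fun j => (N / n j) • f j with hFdef
  have hFG : F ≫ biproduct.map g = N • 𝟙 (⨁ A) := by
    rw [hFdef, biproductMap_comp_biproductMap]
    ext j
    rw [biproduct.map_π, Preadditive.nsmul_comp, hfg j, smul_smul, Nat.div_mul_cancel (hdvd j),
      Preadditive.comp_nsmul, Preadditive.nsmul_comp, Category.comp_id, Category.id_comp]
  intro c hc
  have hGc : complexBetti.map (biproduct.map g).hom.hom.hom (2 * p) c ∈ weilLineClasses B actB (2 * p) :=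
    map_biproductMap_mem_weilLineClasses actA actB g hg (2 * p) hc
  have hback := map_mem_algebraicClasses_of_abelianVariety (p := p)
    (AbelianVariety.isSmoothProjective_holds (A := ⨁ A)) (⨁ B) F.hom.hom.hom (hB hGc)
  have key : complexBetti.map F.hom.hom.hom (2 * p) (complexBetti.map (biproduct.map g).hom.hom.hom (2 * p) c) =
      ((N : ℂ) ^ (2 * p)) • c := by
    rw [abelianVarietyHom_map_map_apply, hFG]
    exact map_nsmul_id_eq_of_mem_weilLineClasses actA (2 * p) N hc
  rw [key] at hback
  have hNC : ((N : ℂ) ^ (2 * p)) ≠ 0 := pow_ne_zero _ (Nat.cast_ne_zero.mpr hN.ne')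
  have h := Submodule.smul_mem (algebraicClasses (⨁ A).X p) (((N : ℂ) ^ (2 * p))⁻¹) hback
  rwa [smul_smul, inv_mul_cancel₀ hNC, one_smul] at h

/-- **Algebraicity of the `K`-Weil line of a family of CM-type realisations depends only on the types.**  If
`(A_j, act^A_j, θ^A_j)` and `(B_j, act^B_j, θ^B_j)` both realise `(K; Ψ_j)` for every `j` (`K` a CM field), and
every `K`-Weil-line class of `⨁ B_j` in degree `2p` is algebraic, then so is every `K`-Weil-line class of `⨁ A_j`
— the slots are equivariantly isogenous by Shimura's Corollary («any two abelian varieties of the same CM-type are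
isogenous … the homomorphism commutes with the operation of F», tree theorem `Shimura1998_Thm2_Cor_holds`).
[cite: Shimura1998, §6.1 Corollary of Theorem 2 and Remark, printed p. 41] [cite: vanGeemen1994HodgeAV, 3.6–3.7] -/
theorem weilLineClasses_le_algebraicClasses_of_isCMTypeRealisation [NumberField K] [IsCMField K] {d : ℕ}
    {Ψ : Fin d → CMType K} {A B : Fin d → AbelianVariety ℂ}
    {actA : ∀ j, 𝓞 K →+* End (A j)} {θA : ∀ j, K →+* Module.End ℂ (complexBetti (A j).X 1)}
    {actB : ∀ j, 𝓞 K →+* End (B j)} {θB : ∀ j, K →+* Module.End ℂ (complexBetti (B j).X 1)}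
    (hA : ∀ j, IsCMTypeRealisation (Ψ j) (A j) (actA j) (θA j))
    (hB : ∀ j, IsCMTypeRealisation (Ψ j) (B j) (actB j) (θB j)) {p : ℕ}
    (h : weilLineClasses B actB (2 * p) ≤ algebraicClasses (⨁ B).X p) :
    weilLineClasses A actA (2 * p) ≤ algebraicClasses (⨁ A).X p := by
  choose g hiso hg using fun j =>
    Shimura1998_Thm2_Cor_holds K (Ψ j) (B j) (actB j) (θB j) (A j) (actA j) (θA j) (hB j) (hA j)
  exact weilLineClasses_le_algebraicClasses_of_equivariant_isogeny actA actB g hg hiso h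

/-- For two realisation families of the same CM types, algebraicity of the `K`-Weil-line classes in degree `2p`
is EQUIVALENT. [cite: Shimura1998, §6.1 Corollary of Theorem 2 and Remark, printed p. 41] -/
theorem weilLineClasses_le_algebraicClasses_iff_of_isCMTypeRealisation [NumberField K] [IsCMField K] {d : ℕ}
    {Ψ : Fin d → CMType K} {A B : Fin d → AbelianVariety ℂ}
    {actA : ∀ j, 𝓞 K →+* End (A j)} {θA : ∀ j, K →+* Module.End ℂ (complexBetti (A j).X 1)}
    {actB : ∀ j, 𝓞 K →+* End (B j)} {θB : ∀ j, K →+* Module.End ℂ (complexBetti (B j).X 1)}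
    (hA : ∀ j, IsCMTypeRealisation (Ψ j) (A j) (actA j) (θA j))
    (hB : ∀ j, IsCMTypeRealisation (Ψ j) (B j) (actB j) (θB j)) (p : ℕ) :
    weilLineClasses A actA (2 * p) ≤ algebraicClasses (⨁ A).X p ↔
      weilLineClasses B actB (2 * p) ≤ algebraicClasses (⨁ B).X p :=
  ⟨weilLineClasses_le_algebraicClasses_of_isCMTypeRealisation hB hA,
    weilLineClasses_le_algebraicClasses_of_isCMTypeRealisation hA hB⟩

end Literature.AlgebraicGeometry.HodgeTheory

end
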